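import Summits.CriticalPhenomena.PercolationContinuityZ3.Theorems.PercNearOneGluingNoHeavyLowerTailCubicThreePointIncTwinClosure
import HarnessLib

/-!
# `NoHeavyLowerTail` (stmt-CriticalPhenomena-4575) — the open cubic rows AG⁺ (`Ξ`) and `H_{q+t}` are each closed under parallel (join) and series-type
# (meet) composition of three-point laws: minimal counterexamples are prime

Support file (prover prim-sahi-p2 gen 2, SAHI cell P2; `--supports stmt-CriticalPhenomena-4575`).  No definitions, no named facts, no sorries; pure real algebra
plus the cell calculus of `…CubicThreePointGluingJoinCells`.  Companion of `…CubicThreePointIncTwinClosure` (the same for the weak twin rows `F` = 3PT-LB and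
`T_inc`) and of kcluster's `maxH_join_nonneg` / `maxH_meet_nonneg` (the sharp region `{AG ≥ 0, max(Ha,Hb) ≥ 0}`).  With this file EVERY row of the chain
`Hmax ⇒ H_{q+t} ⇒ AG⁺ ⇒ {F, T_inc}` (`…CubicThreePointTightFamilies`) is, together with Gladkov's `AG ≥ 0`, a K3-semigroup on its own: preserved by gluing two
three-terminal networks along the terminal triple and by the dual composition — with no regime dichotomy in the hypotheses.
* `Xi_join_nonneg` — `{AG ≥ 0, Ξ ≥ 0}` (`Ξ = σ·AG − e₃`, AG⁺: `qt ≥ e₂ + e₃` on the simplex) is join-closed: exact LP certificate (kit j081506; 276 products, denominators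
  ≤ 12, all coefficients positive), checked by `ring`, then `positivity`;  `Xi_meet_nonneg` — by the `q ↔ t` self-duality `Xi_dual`;
* `Hqt_join_nonneg` — `{AG ≥ 0, H_{q+t} ≥ 0}` (`H_{q+t} = (q+t)·AG − e₃`) is join-closed (kit j081508; 247 products, denominators ≤ 12);  `Hqt_meet_nonneg` (`Hqt_dual`);
* `TerminalGluing.xiW_join_nonneg`, `TerminalGluing.hqtW_join_nonneg` — graph level: gluing two edge systems along `a, b, c` preserves AG⁺, resp. `H_{q+t}`, of the
  finitary law (`PrW_join_*`, `AG_PrW_nonneg`).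
Both rows are OPEN on general graphs (kernel for `≤ 5` vertices: `…FibreThetaHqt`; certificate for `≤ 6`: kit j072389); these theorems say a minimal violating graph admits no
terminal-triple separation (and, by the meet versions with arm laws, no pendant decomposition).
[cite: Gladkov2024StrongFKG, Cor. 4.2 (AG)]
-/

namespace Summit.CriticalPhenomena.PercolationContinuityZ3.Theorems

namespace CubicThreePointRowClosure

open CubicThreePointTerminal CubicThreePointStep CubicThreePointSharp

/-- `Ξ` is self-dual under `q ↔ t`. [folklore] -/
theorem Xi_dual (q u₁ u₂ u₃ t : ℝ) : Xi t u₁ u₂ u₃ q = Xi q u₁ u₂ u₃ t := by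
  simp only [Xi]; ring

/-- `H_{q+t}` is self-dual under `q ↔ t`. [folklore] -/
theorem Hqt_dual (q u₁ u₂ u₃ t : ℝ) : Hqt t u₁ u₂ u₃ q = Hqt q u₁ u₂ u₃ t := by
  simp only [Hqt]; ring

set_option maxHeartbeats 4000000 in
set_option maxRecDepth 8000 in
/-- **`{AG ≥ 0, Ξ ≥ 0}` (AG⁺) is closed under the join composition.**  Exact LP certificate (kit j081506), verified by `ring`.
[cite: Gladkov2024StrongFKG, Cor. 4.2 (AG)] -/
theorem Xi_join_nonneg {q u₁ u₂ u₃ t Q v₁ v₂ v₃ T zq z₁ z₂ z₃ zt : ℝ}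
    (hq : 0 ≤ q) (hu₁ : 0 ≤ u₁) (hu₂ : 0 ≤ u₂) (hu₃ : 0 ≤ u₃) (ht : 0 ≤ t)
    (hQ : 0 ≤ Q) (hv₁ : 0 ≤ v₁) (hv₂ : 0 ≤ v₂) (hv₃ : 0 ≤ v₃) (hT : 0 ≤ T)
    (hagx : 0 ≤ AG q u₁ u₂ u₃ t) (hagy : 0 ≤ AG Q v₁ v₂ v₃ T)
    (hrx : 0 ≤ Xi q u₁ u₂ u₃ t) (hry : 0 ≤ Xi Q v₁ v₂ v₃ T)
    (hzq : zq = q * Q) (hz₁ : z₁ = q * v₁ + u₁ * Q + u₁ * v₁) (hz₂ : z₂ = q * v₂ + u₂ * Q + u₂ * v₂)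
    (hz₃ : z₃ = q * v₃ + u₃ * Q + u₃ * v₃)
    (hzt : zt = t * (Q + v₁ + v₂ + v₃ + T) + T * (q + u₁ + u₂ + u₃) + (u₁ * (v₂ + v₃) + u₂ * (v₁ + v₃) + u₃ * (v₁ + v₂))) :
    0 ≤ Xi zq z₁ z₂ z₃ zt := by
  subst hzq hz₁ hz₂ hz₃ hzt
  have key : Xi (q * Q) (q * v₁ + u₁ * Q + u₁ * v₁) (q * v₂ + u₂ * Q + u₂ * v₂) (q * v₃ + u₃ * Q + u₃ * v₃)
        (t * (Q + v₁ + v₂ + v₃ + T) + T * (q + u₁ + u₂ + u₃) + (u₁ * (v₂ + v₃) + u₂ * (v₁ + v₃) + u₃ * (v₁ + v₂))) =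
      ((2:ℝ) * q * q * u₁ * v₁ * v₂ * v₃ + q * q * u₁ * v₂ * v₂ * v₃ + q * q * u₁ * v₂ * v₃ * v₃ + q * q * u₁ * v₂ * v₃ * T
          + q * q * u₂ * v₁ * v₁ * v₃ + (2:ℝ) * q * q * u₂ * v₁ * v₂ * v₃ + q * q * u₂ * v₁ * v₃ * v₃ + q * q * u₂ * v₁ * v₃ * T
          + q * q * u₃ * v₁ * v₁ * v₂ + q * q * u₃ * v₁ * v₂ * v₂ + (2:ℝ) * q * q * u₃ * v₁ * v₂ * v₃ + q * q * u₃ * v₁ * v₂ * T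
          + (4:ℝ) * q * q * t * v₁ * v₂ * v₃ + q * u₁ * u₁ * Q * v₂ * v₃ + (2:ℝ) * q * u₁ * u₁ * v₁ * v₂ * v₃ + q * u₁ * u₁ * v₂ * v₂ * v₃
          + q * u₁ * u₁ * v₂ * v₃ * v₃ + q * u₁ * u₁ * v₂ * v₃ * T + (2:ℝ) * q * u₁ * u₂ * Q * v₁ * v₃ + (2:ℝ) * q * u₁ * u₂ * Q * v₂ * v₃
          + q * u₁ * u₂ * Q * v₃ * v₃ + q * u₁ * u₂ * Q * v₃ * T + (2:ℝ) * q * u₁ * u₂ * v₁ * v₁ * v₃ + (3:ℝ) * q * u₁ * u₂ * v₁ * v₂ * v₃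
          + (2:ℝ) * q * u₁ * u₂ * v₁ * v₃ * v₃ + (2:ℝ) * q * u₁ * u₂ * v₁ * v₃ * T + (2:ℝ) * q * u₁ * u₂ * v₂ * v₂ * v₃ + (2:ℝ) * q * u₁ * u₂ * v₂ * v₃ * v₃
          + (2:ℝ) * q * u₁ * u₂ * v₂ * v₃ * T + (2:ℝ) * q * u₁ * u₃ * Q * v₁ * v₂ + q * u₁ * u₃ * Q * v₂ * v₂ + (2:ℝ) * q * u₁ * u₃ * Q * v₂ * v₃
          + ((5:ℝ)/2) * q * u₁ * u₃ * Q * v₂ * T + (2:ℝ) * q * u₁ * u₃ * v₁ * v₁ * v₂ + ((1:ℝ)/2) * q * u₁ * u₃ * v₁ * v₂ * v₂ + (2:ℝ) * q * u₁ * u₃ * v₁ * v₂ * T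
          + ((1:ℝ)/2) * q * u₁ * u₃ * v₂ * v₂ * v₃ + (2:ℝ) * q * u₁ * u₃ * v₂ * v₃ * v₃ + (2:ℝ) * q * u₁ * u₃ * v₂ * v₃ * T + (3:ℝ) * q * u₁ * t * Q * v₂ * v₃
          + (5:ℝ) * q * u₁ * t * v₁ * v₂ * v₃ + q * u₁ * t * v₂ * v₂ * v₃ + ((7:ℝ)/4) * q * u₁ * t * v₂ * v₃ * v₃ + ((7:ℝ)/4) * q * u₁ * t * v₂ * v₃ * T
          + q * u₂ * u₂ * Q * v₁ * v₃ + q * u₂ * u₂ * v₁ * v₁ * v₃ + (2:ℝ) * q * u₂ * u₂ * v₁ * v₂ * v₃ + q * u₂ * u₂ * v₁ * v₃ * v₃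
          + q * u₂ * u₂ * v₁ * v₃ * T + q * u₂ * u₃ * Q * v₁ * v₁ + (2:ℝ) * q * u₂ * u₃ * Q * v₁ * v₂ + (2:ℝ) * q * u₂ * u₃ * Q * v₁ * v₃
          + ((5:ℝ)/2) * q * u₂ * u₃ * Q * v₁ * T + ((1:ℝ)/2) * q * u₂ * u₃ * v₁ * v₁ * v₂ + ((1:ℝ)/2) * q * u₂ * u₃ * v₁ * v₁ * v₃ + (2:ℝ) * q * u₂ * u₃ * v₁ * v₂ * v₂
          + (2:ℝ) * q * u₂ * u₃ * v₁ * v₂ * T + (2:ℝ) * q * u₂ * u₃ * v₁ * v₃ * v₃ + (2:ℝ) * q * u₂ * u₃ * v₁ * v₃ * T + q * u₂ * t * Q * v₁ * v₃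
          + q * u₂ * t * v₁ * v₁ * v₃ + (5:ℝ) * q * u₂ * t * v₁ * v₂ * v₃ + q * u₂ * t * v₁ * v₃ * v₃ + ((7:ℝ)/4) * q * u₂ * t * v₁ * v₃ * T
          + q * u₃ * u₃ * Q * v₁ * v₂ + q * u₃ * u₃ * v₁ * v₁ * v₂ + q * u₃ * u₃ * v₁ * v₂ * v₂ + (2:ℝ) * q * u₃ * u₃ * v₁ * v₂ * v₃
          + q * u₃ * u₃ * v₁ * v₂ * T + (3:ℝ) * q * u₃ * t * Q * v₁ * v₂ + ((7:ℝ)/4) * q * u₃ * t * v₁ * v₁ * v₂ + ((7:ℝ)/4) * q * u₃ * t * v₁ * v₂ * v₂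
          + (5:ℝ) * q * u₃ * t * v₁ * v₂ * v₃ + ((7:ℝ)/4) * q * u₃ * t * v₁ * v₂ * T + (3:ℝ) * q * t * t * v₁ * v₂ * v₃ + u₁ * u₁ * u₂ * Q * Q * v₃
          + (2:ℝ) * u₁ * u₁ * u₂ * Q * v₁ * v₃ + u₁ * u₁ * u₂ * Q * v₃ * v₃ + u₁ * u₁ * u₂ * Q * v₃ * T + u₁ * u₁ * u₂ * v₁ * v₁ * v₃
          + u₁ * u₁ * u₂ * v₁ * v₃ * v₃ + u₁ * u₁ * u₂ * v₁ * v₃ * T + u₁ * u₁ * u₂ * v₂ * v₂ * v₃ + ((1:ℝ)/4) * u₁ * u₁ * u₂ * v₂ * v₃ * v₃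
          + ((1:ℝ)/4) * u₁ * u₁ * u₂ * v₂ * v₃ * T + u₁ * u₁ * u₃ * Q * Q * v₂ + (2:ℝ) * u₁ * u₁ * u₃ * Q * v₁ * v₂ + u₁ * u₁ * u₃ * Q * v₂ * v₂
          + u₁ * u₁ * u₃ * Q * v₂ * T + u₁ * u₁ * u₃ * v₁ * v₁ * v₂ + u₁ * u₁ * u₃ * v₁ * v₂ * v₂ + u₁ * u₁ * u₃ * v₁ * v₂ * T
          + u₁ * u₁ * u₃ * v₂ * v₂ * v₃ + ((1:ℝ)/4) * u₁ * u₁ * u₃ * v₂ * v₃ * v₃ + ((1:ℝ)/4) * u₁ * u₁ * u₃ * v₂ * v₃ * T + u₁ * u₂ * u₂ * Q * Q * v₃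
          + (2:ℝ) * u₁ * u₂ * u₂ * Q * v₁ * v₃ + (2:ℝ) * u₁ * u₂ * u₂ * Q * v₂ * v₃ + u₁ * u₂ * u₂ * Q * v₃ * v₃ + u₁ * u₂ * u₂ * Q * v₃ * T
          + u₁ * u₂ * u₂ * v₁ * v₁ * v₃ + u₁ * u₂ * u₂ * v₁ * v₃ * v₃ + ((1:ℝ)/4) * u₁ * u₂ * u₂ * v₁ * v₃ * T + u₁ * u₂ * u₂ * v₂ * v₂ * v₃
          + u₁ * u₂ * u₂ * v₂ * v₃ * v₃ + u₁ * u₂ * u₂ * v₂ * v₃ * T + (2:ℝ) * u₁ * u₂ * u₃ * Q * Q * v₁ + (2:ℝ) * u₁ * u₂ * u₃ * Q * Q * v₂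
          + (2:ℝ) * u₁ * u₂ * u₃ * Q * Q * v₃ + (2:ℝ) * u₁ * u₂ * u₃ * Q * Q * T + (2:ℝ) * u₁ * u₂ * u₃ * Q * v₁ * v₁ + u₁ * u₂ * u₃ * Q * v₁ * v₂
          + (5:ℝ) * u₁ * u₂ * u₃ * Q * v₁ * v₃ + (2:ℝ) * u₁ * u₂ * u₃ * Q * v₂ * v₂ + u₁ * u₂ * u₃ * Q * v₂ * v₃ + (3:ℝ) * u₁ * u₂ * u₃ * Q * v₂ * T
          + (2:ℝ) * u₁ * u₂ * u₃ * Q * v₃ * v₃ + (2:ℝ) * u₁ * u₂ * u₃ * Q * v₃ * T + u₁ * u₂ * u₃ * Q * T * T + ((7:ℝ)/2) * u₁ * u₂ * u₃ * v₁ * v₁ * v₂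
          + (5:ℝ) * u₁ * u₂ * u₃ * v₁ * v₁ * v₃ + ((1:ℝ)/2) * u₁ * u₂ * u₃ * v₁ * v₂ * v₂ + ((1:ℝ)/2) * u₁ * u₂ * u₃ * v₁ * v₂ * T + (3:ℝ) * u₁ * u₂ * u₃ * v₁ * v₃ * v₃
          + ((1:ℝ)/2) * u₁ * u₂ * u₃ * v₁ * v₃ * T + (2:ℝ) * u₁ * u₂ * u₃ * v₂ * v₂ * v₃ + ((3:ℝ)/2) * u₁ * u₂ * u₃ * v₂ * v₃ * v₃ + ((1:ℝ)/2) * u₁ * u₂ * u₃ * v₂ * v₃ * T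
          + u₁ * u₂ * t * Q * Q * v₃ + (2:ℝ) * u₁ * u₂ * t * Q * v₁ * v₃ + (2:ℝ) * u₁ * u₂ * t * Q * v₂ * v₃ + u₁ * u₂ * t * Q * v₃ * v₃
          + u₁ * u₂ * t * Q * v₃ * T + u₁ * u₂ * t * v₁ * v₁ * v₃ + u₁ * u₂ * t * v₁ * v₃ * v₃ + u₁ * u₂ * t * v₁ * v₃ * T
          + u₁ * u₂ * t * v₂ * v₂ * v₃ + u₁ * u₂ * t * v₂ * v₃ * v₃ + u₁ * u₂ * t * v₂ * v₃ * T + u₁ * u₃ * u₃ * Q * Q * v₂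
          + u₁ * u₃ * u₃ * Q * v₂ * v₂ + (2:ℝ) * u₁ * u₃ * u₃ * Q * v₂ * v₃ + u₁ * u₃ * u₃ * Q * v₂ * T + ((1:ℝ)/4) * u₁ * u₃ * u₃ * v₁ * v₁ * v₂
          + ((1:ℝ)/4) * u₁ * u₃ * u₃ * v₁ * v₂ * v₂ + ((1:ℝ)/4) * u₁ * u₃ * u₃ * v₁ * v₂ * T + u₁ * u₃ * u₃ * v₂ * v₂ * v₃ + u₁ * u₃ * u₃ * v₂ * v₃ * v₃
          + u₁ * u₃ * u₃ * v₂ * v₃ * T + u₁ * u₃ * t * Q * Q * v₂ + (2:ℝ) * u₁ * u₃ * t * Q * v₁ * v₂ + u₁ * u₃ * t * Q * v₂ * v₂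
          + (2:ℝ) * u₁ * u₃ * t * Q * v₂ * v₃ + u₁ * u₃ * t * Q * v₂ * T + u₁ * u₃ * t * v₁ * v₁ * v₂ + u₁ * u₃ * t * v₁ * v₂ * v₂
          + u₁ * u₃ * t * v₁ * v₂ * T + u₁ * u₃ * t * v₂ * v₂ * v₃ + u₁ * u₃ * t * v₂ * v₃ * v₃ + u₁ * u₃ * t * v₂ * v₃ * T
          + u₂ * u₂ * u₃ * Q * Q * v₁ + u₂ * u₂ * u₃ * Q * v₁ * v₁ + (2:ℝ) * u₂ * u₂ * u₃ * Q * v₁ * v₂ + (2:ℝ) * u₂ * u₂ * u₃ * Q * v₁ * v₃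
          + u₂ * u₂ * u₃ * Q * v₁ * T + u₂ * u₂ * u₃ * v₁ * v₁ * v₂ + u₂ * u₂ * u₃ * v₁ * v₁ * v₃ + u₂ * u₂ * u₃ * v₁ * v₂ * v₂
          + u₂ * u₂ * u₃ * v₁ * v₂ * T + u₂ * u₂ * u₃ * v₁ * v₃ * v₃ + ((1:ℝ)/4) * u₂ * u₂ * u₃ * v₁ * v₃ * T + u₂ * u₃ * u₃ * Q * Q * v₁
          + u₂ * u₃ * u₃ * Q * v₁ * v₁ + (2:ℝ) * u₂ * u₃ * u₃ * Q * v₁ * v₃ + u₂ * u₃ * u₃ * Q * v₁ * T + ((1:ℝ)/4) * u₂ * u₃ * u₃ * v₁ * v₁ * v₂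
          + u₂ * u₃ * u₃ * v₁ * v₁ * v₃ + ((1:ℝ)/4) * u₂ * u₃ * u₃ * v₁ * v₂ * v₂ + ((1:ℝ)/4) * u₂ * u₃ * u₃ * v₁ * v₂ * T + u₂ * u₃ * u₃ * v₁ * v₃ * v₃
          + u₂ * u₃ * u₃ * v₁ * v₃ * T + u₂ * u₃ * t * Q * Q * v₁ + u₂ * u₃ * t * Q * v₁ * v₁ + (2:ℝ) * u₂ * u₃ * t * Q * v₁ * v₂
          + (2:ℝ) * u₂ * u₃ * t * Q * v₁ * v₃ + u₂ * u₃ * t * Q * v₁ * T + u₂ * u₃ * t * v₁ * v₁ * v₂ + u₂ * u₃ * t * v₁ * v₁ * v₃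
          + u₂ * u₃ * t * v₁ * v₂ * v₂ + u₂ * u₃ * t * v₁ * v₂ * T + u₂ * u₃ * t * v₁ * v₃ * v₃ + u₂ * u₃ * t * v₁ * v₃ * T)
      + ((2:ℝ) * q * Q * v₁ * v₂ + (2:ℝ) * q * Q * v₂ * v₃ + ((3:ℝ)/4) * q * v₁ * v₁ * v₂ + ((3:ℝ)/4) * q * v₁ * v₂ * v₂
          + ((3:ℝ)/4) * q * v₁ * v₂ * T + ((3:ℝ)/4) * q * v₁ * v₃ * T + ((3:ℝ)/4) * q * v₂ * v₃ * v₃ + ((3:ℝ)/4) * q * v₂ * v₃ * T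
          + (2:ℝ) * u₁ * Q * v₁ * v₂ + ((3:ℝ)/4) * u₁ * v₁ * v₁ * v₂ + ((3:ℝ)/4) * u₁ * v₁ * v₂ * v₂ + ((3:ℝ)/4) * u₁ * v₁ * v₂ * T
          + ((3:ℝ)/4) * u₁ * v₁ * v₃ * T + (2:ℝ) * u₂ * Q * v₁ * v₂ + (2:ℝ) * u₂ * Q * v₂ * v₃ + ((3:ℝ)/4) * u₂ * v₁ * v₁ * v₂
          + ((3:ℝ)/4) * u₂ * v₁ * v₂ * v₂ + ((3:ℝ)/4) * u₂ * v₁ * v₂ * T + ((3:ℝ)/4) * u₂ * v₂ * v₃ * v₃ + ((3:ℝ)/4) * u₂ * v₂ * v₃ * T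
          + (2:ℝ) * u₃ * Q * v₂ * v₃ + ((3:ℝ)/4) * u₃ * v₁ * v₃ * T + ((3:ℝ)/4) * u₃ * v₂ * v₃ * v₃ + ((3:ℝ)/4) * u₃ * v₂ * v₃ * T
          + (2:ℝ) * t * Q * v₁ * v₂ + (2:ℝ) * t * Q * v₂ * v₃ + ((3:ℝ)/4) * t * v₁ * v₁ * v₂ + ((3:ℝ)/4) * t * v₁ * v₂ * v₂
          + ((3:ℝ)/4) * t * v₁ * v₂ * T + ((3:ℝ)/4) * t * v₁ * v₃ * T + ((3:ℝ)/4) * t * v₂ * v₃ * v₃ + ((3:ℝ)/4) * t * v₂ * v₃ * T) * ((AG q u₁ u₂ u₃ t))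
      + (((3:ℝ)/2) * q * u₁ * u₃ * Q + ((3:ℝ)/2) * q * u₁ * u₃ * v₁ + ((3:ℝ)/2) * q * u₁ * u₃ * v₃ + ((3:ℝ)/2) * q * u₁ * u₃ * T
          + ((3:ℝ)/2) * q * u₂ * u₃ * Q + ((3:ℝ)/2) * q * u₂ * u₃ * v₂ + ((3:ℝ)/2) * q * u₂ * u₃ * v₃ + ((3:ℝ)/2) * q * u₂ * u₃ * T
          + (3:ℝ) * u₁ * u₂ * u₃ * v₁ + u₁ * u₂ * u₃ * v₃) * ((AG Q v₁ v₂ v₃ T))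
      + (Q * Q * Q + (2:ℝ) * Q * Q * v₁ + (2:ℝ) * Q * Q * v₂ + (2:ℝ) * Q * Q * v₃
          + ((5:ℝ)/4) * Q * Q * T + Q * v₁ * v₁ + ((3:ℝ)/4) * Q * v₁ * v₂ + ((11:ℝ)/4) * Q * v₁ * v₃
          + ((5:ℝ)/4) * Q * v₁ * T + Q * v₂ * v₂ + ((3:ℝ)/4) * Q * v₂ * v₃ + ((5:ℝ)/4) * Q * v₂ * T
          + Q * v₃ * v₃ + ((5:ℝ)/4) * Q * v₃ * T + ((1:ℝ)/4) * Q * T * T + ((3:ℝ)/4) * v₁ * v₁ * v₃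
          + ((3:ℝ)/4) * v₁ * v₃ * v₃ + ((3:ℝ)/4) * v₂ * v₂ * v₃) * ((Xi q u₁ u₂ u₃ t))
      + (q * q * q + (2:ℝ) * q * q * u₁ + (2:ℝ) * q * q * u₂ + (2:ℝ) * q * q * u₃
          + ((7:ℝ)/4) * q * q * t + q * u₁ * u₁ + ((9:ℝ)/4) * q * u₁ * u₂ + ((3:ℝ)/4) * q * u₁ * u₃
          + ((7:ℝ)/4) * q * u₁ * t + q * u₂ * u₂ + ((3:ℝ)/4) * q * u₂ * u₃ + ((7:ℝ)/4) * q * u₂ * t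
          + q * u₃ * u₃ + ((7:ℝ)/4) * q * u₃ * t + ((3:ℝ)/4) * q * t * t + ((1:ℝ)/4) * u₁ * u₁ * u₂
          + ((1:ℝ)/4) * u₁ * u₁ * u₃ + ((1:ℝ)/4) * u₁ * u₂ * u₂ + ((1:ℝ)/4) * u₁ * u₂ * t + ((1:ℝ)/4) * u₁ * u₃ * u₃
          + ((1:ℝ)/4) * u₁ * u₃ * t + ((1:ℝ)/4) * u₂ * u₂ * u₃ + ((1:ℝ)/4) * u₂ * u₃ * u₃ + ((1:ℝ)/4) * u₂ * u₃ * t) * ((Xi Q v₁ v₂ v₃ T)) := by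
    simp only [Xi, AG]; ring
  rw [key]
  generalize Xi q u₁ u₂ u₃ t = RX at hrx ⊢
  generalize Xi Q v₁ v₂ v₃ T = RY at hry ⊢
  generalize AG q u₁ u₂ u₃ t = AX at hagx ⊢
  generalize AG Q v₁ v₂ v₃ T = AY at hagy ⊢
  positivity

set_option maxHeartbeats 4000000 in
set_option maxRecDepth 8000 in
/-- **`{AG ≥ 0, H_{q+t} ≥ 0}` is closed under the join composition.**  Exact LP certificate (kit j081508), verified by `ring`.
[cite: Gladkov2024StrongFKG, Cor. 4.2 (AG)] -/
theorem Hqt_join_nonneg {q u₁ u₂ u₃ t Q v₁ v₂ v₃ T zq z₁ z₂ z₃ zt : ℝ}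
    (hq : 0 ≤ q) (hu₁ : 0 ≤ u₁) (hu₂ : 0 ≤ u₂) (hu₃ : 0 ≤ u₃) (ht : 0 ≤ t)
    (hQ : 0 ≤ Q) (hv₁ : 0 ≤ v₁) (hv₂ : 0 ≤ v₂) (hv₃ : 0 ≤ v₃) (hT : 0 ≤ T)
    (hagx : 0 ≤ AG q u₁ u₂ u₃ t) (hagy : 0 ≤ AG Q v₁ v₂ v₃ T)
    (hrx : 0 ≤ Hqt q u₁ u₂ u₃ t) (hry : 0 ≤ Hqt Q v₁ v₂ v₃ T)
    (hzq : zq = q * Q) (hz₁ : z₁ = q * v₁ + u₁ * Q + u₁ * v₁) (hz₂ : z₂ = q * v₂ + u₂ * Q + u₂ * v₂)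
    (hz₃ : z₃ = q * v₃ + u₃ * Q + u₃ * v₃)
    (hzt : zt = t * (Q + v₁ + v₂ + v₃ + T) + T * (q + u₁ + u₂ + u₃) + (u₁ * (v₂ + v₃) + u₂ * (v₁ + v₃) + u₃ * (v₁ + v₂))) :
    0 ≤ Hqt zq z₁ z₂ z₃ zt := by
  subst hzq hz₁ hz₂ hz₃ hzt
  have key : Hqt (q * Q) (q * v₁ + u₁ * Q + u₁ * v₁) (q * v₂ + u₂ * Q + u₂ * v₂) (q * v₃ + u₃ * Q + u₃ * v₃)
        (t * (Q + v₁ + v₂ + v₃ + T) + T * (q + u₁ + u₂ + u₃) + (u₁ * (v₂ + v₃) + u₂ * (v₁ + v₃) + u₃ * (v₁ + v₂))) =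
      (q * q * u₁ * v₂ * v₃ * T + q * q * u₂ * v₁ * v₃ * T + q * q * u₃ * v₁ * v₂ * T + q * u₁ * u₁ * v₂ * v₂ * v₃
          + q * u₁ * u₁ * v₂ * v₃ * v₃ + q * u₁ * u₁ * v₂ * v₃ * T + (2:ℝ) * q * u₁ * u₂ * Q * v₃ * T + (2:ℝ) * q * u₁ * u₂ * v₁ * v₃ * T
          + (2:ℝ) * q * u₁ * u₂ * v₂ * v₃ * T + (2:ℝ) * q * u₁ * u₃ * Q * v₂ * T + (2:ℝ) * q * u₁ * u₃ * v₁ * v₂ * T + (2:ℝ) * q * u₁ * u₃ * v₂ * v₃ * T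
          + (2:ℝ) * q * u₁ * t * Q * v₂ * v₃ + (3:ℝ) * q * u₁ * t * v₁ * v₂ * v₃ + (2:ℝ) * q * u₁ * t * v₂ * v₂ * v₃ + (2:ℝ) * q * u₁ * t * v₂ * v₃ * v₃
          + ((3:ℝ)/2) * q * u₁ * t * v₂ * v₃ * T + q * u₂ * u₂ * v₁ * v₁ * v₃ + q * u₂ * u₂ * v₁ * v₃ * v₃ + q * u₂ * u₂ * v₁ * v₃ * T
          + (2:ℝ) * q * u₂ * u₃ * Q * v₁ * T + (2:ℝ) * q * u₂ * u₃ * v₁ * v₂ * T + (2:ℝ) * q * u₂ * u₃ * v₁ * v₃ * T + (2:ℝ) * q * u₂ * t * Q * v₁ * v₃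
          + (2:ℝ) * q * u₂ * t * v₁ * v₁ * v₃ + (2:ℝ) * q * u₂ * t * v₁ * v₂ * v₃ + q * u₂ * t * v₁ * v₃ * v₃ + q * u₂ * t * v₁ * v₃ * T
          + q * u₃ * u₃ * v₁ * v₁ * v₂ + q * u₃ * u₃ * v₁ * v₂ * v₂ + q * u₃ * u₃ * v₁ * v₂ * T + (2:ℝ) * q * u₃ * t * Q * v₁ * v₂
          + (2:ℝ) * q * u₃ * t * v₁ * v₁ * v₂ + (2:ℝ) * q * u₃ * t * v₁ * v₂ * v₂ + (3:ℝ) * q * u₃ * t * v₁ * v₂ * v₃ + ((3:ℝ)/2) * q * u₃ * t * v₁ * v₂ * T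
          + (2:ℝ) * q * t * t * v₁ * v₂ * v₃ + u₁ * u₁ * u₂ * Q * v₃ * v₃ + u₁ * u₁ * u₂ * Q * v₃ * T + u₁ * u₁ * u₂ * v₁ * v₃ * v₃
          + u₁ * u₁ * u₂ * v₁ * v₃ * T + ((1:ℝ)/2) * u₁ * u₁ * u₂ * v₂ * v₃ * T + u₁ * u₁ * u₃ * Q * v₂ * v₂ + u₁ * u₁ * u₃ * Q * v₂ * T
          + u₁ * u₁ * u₃ * v₁ * v₂ * v₂ + u₁ * u₁ * u₃ * v₁ * v₂ * T + ((1:ℝ)/2) * u₁ * u₁ * u₃ * v₂ * v₃ * T + u₁ * u₂ * u₂ * Q * v₃ * v₃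
          + (2:ℝ) * u₁ * u₂ * u₂ * Q * v₃ * T + u₁ * u₂ * u₂ * v₁ * v₃ * T + u₁ * u₂ * u₂ * v₂ * v₃ * T + (2:ℝ) * u₁ * u₂ * u₃ * Q * Q * T
          + u₁ * u₂ * u₃ * Q * v₁ * T + (2:ℝ) * u₁ * u₂ * u₃ * Q * v₂ * T + (2:ℝ) * u₁ * u₂ * u₃ * Q * v₃ * T + (2:ℝ) * u₁ * u₂ * u₃ * Q * T * T
          + u₁ * u₂ * t * Q * Q * v₃ + (2:ℝ) * u₁ * u₂ * t * Q * v₁ * v₃ + (2:ℝ) * u₁ * u₂ * t * Q * v₂ * v₃ + u₁ * u₂ * t * Q * v₃ * v₃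
          + (2:ℝ) * u₁ * u₂ * t * Q * v₃ * T + u₁ * u₂ * t * v₁ * v₁ * v₃ + u₁ * u₂ * t * v₁ * v₃ * T + u₁ * u₂ * t * v₂ * v₂ * v₃
          + u₁ * u₂ * t * v₂ * v₃ * T + u₁ * u₃ * u₃ * Q * v₂ * v₂ + u₁ * u₃ * u₃ * Q * v₂ * T + ((1:ℝ)/2) * u₁ * u₃ * u₃ * v₁ * v₂ * T
          + u₁ * u₃ * u₃ * v₂ * v₂ * v₃ + u₁ * u₃ * u₃ * v₂ * v₃ * T + u₁ * u₃ * t * Q * Q * v₂ + (2:ℝ) * u₁ * u₃ * t * Q * v₁ * v₂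
          + u₁ * u₃ * t * Q * v₂ * v₂ + (2:ℝ) * u₁ * u₃ * t * Q * v₂ * v₃ + (2:ℝ) * u₁ * u₃ * t * Q * v₂ * T + u₁ * u₃ * t * v₁ * v₁ * v₂
          + u₁ * u₃ * t * v₁ * v₂ * T + u₁ * u₃ * t * v₂ * v₃ * v₃ + u₁ * u₃ * t * v₂ * v₃ * T + u₂ * u₂ * u₃ * Q * v₁ * v₁
          + u₂ * u₂ * u₃ * Q * v₁ * T + u₂ * u₂ * u₃ * v₁ * v₁ * v₂ + u₂ * u₂ * u₃ * v₁ * v₂ * v₃ + u₂ * u₂ * u₃ * v₁ * v₂ * T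
          + u₂ * u₂ * u₃ * v₁ * v₃ * v₃ + u₂ * u₂ * u₃ * v₁ * v₃ * T + u₂ * u₃ * u₃ * Q * v₁ * v₁ + u₂ * u₃ * u₃ * Q * v₁ * T
          + u₂ * u₃ * u₃ * v₁ * v₁ * v₃ + ((1:ℝ)/2) * u₂ * u₃ * u₃ * v₁ * v₂ * T + u₂ * u₃ * u₃ * v₁ * v₃ * T + u₂ * u₃ * t * Q * Q * v₁
          + u₂ * u₃ * t * Q * v₁ * v₁ + (2:ℝ) * u₂ * u₃ * t * Q * v₁ * v₂ + (2:ℝ) * u₂ * u₃ * t * Q * v₁ * v₃ + (2:ℝ) * u₂ * u₃ * t * Q * v₁ * T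
          + u₂ * u₃ * t * v₁ * v₂ * v₂ + u₂ * u₃ * t * v₁ * v₂ * T + u₂ * u₃ * t * v₁ * v₃ * v₃ + u₂ * u₃ * t * v₁ * v₃ * T)
      + (q * Q * v₁ * T + q * v₁ * v₂ * v₃ + ((1:ℝ)/2) * q * v₁ * v₂ * T + q * v₁ * v₃ * v₃
          + q * v₁ * v₃ * T + ((1:ℝ)/2) * q * v₂ * v₃ * T + u₁ * Q * Q * v₂ + u₁ * Q * Q * v₃
          + ((3:ℝ)/2) * u₁ * Q * Q * T + ((1:ℝ)/2) * u₁ * Q * v₁ * v₂ + ((1:ℝ)/2) * u₁ * Q * v₁ * v₃ + u₁ * Q * v₁ * T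
          + u₁ * Q * v₂ * v₂ + ((1:ℝ)/2) * u₁ * Q * v₂ * v₃ + u₁ * Q * v₂ * T + u₁ * Q * v₃ * v₃
          + u₁ * Q * v₃ * T + ((1:ℝ)/2) * u₁ * Q * T * T + u₁ * v₁ * v₂ * v₂ + ((1:ℝ)/2) * u₁ * v₁ * v₂ * v₃
          + ((1:ℝ)/2) * u₁ * v₁ * v₂ * T + u₁ * v₁ * v₃ * v₃ + ((1:ℝ)/2) * u₁ * v₁ * v₃ * T + u₂ * Q * Q * v₁
          + u₂ * Q * Q * v₃ + (2:ℝ) * u₂ * Q * Q * T + u₂ * Q * v₁ * v₁ + u₂ * Q * v₁ * T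
          + u₂ * Q * v₂ * T + u₂ * Q * v₃ * v₃ + (2:ℝ) * u₂ * Q * v₃ * T + u₂ * Q * T * T
          + u₂ * v₁ * v₁ * v₂ + u₃ * Q * Q * v₁ + u₃ * Q * Q * v₂ + ((3:ℝ)/2) * u₃ * Q * Q * T
          + u₃ * Q * v₁ * v₁ + ((1:ℝ)/2) * u₃ * Q * v₁ * v₂ + ((1:ℝ)/2) * u₃ * Q * v₁ * v₃ + u₃ * Q * v₁ * T
          + u₃ * Q * v₂ * v₂ + ((1:ℝ)/2) * u₃ * Q * v₂ * v₃ + u₃ * Q * v₂ * T + u₃ * Q * v₃ * T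
          + ((1:ℝ)/2) * u₃ * Q * T * T + u₃ * v₁ * v₁ * v₃ + ((1:ℝ)/2) * u₃ * v₁ * v₂ * v₃ + ((1:ℝ)/2) * u₃ * v₁ * v₃ * T
          + u₃ * v₂ * v₂ * v₃ + ((1:ℝ)/2) * u₃ * v₂ * v₃ * T + t * Q * Q * v₁ + t * Q * Q * v₂
          + t * Q * Q * v₃ + ((3:ℝ)/2) * t * Q * Q * T + t * Q * v₁ * v₁ + ((1:ℝ)/2) * t * Q * v₁ * v₂
          + ((1:ℝ)/2) * t * Q * v₁ * v₃ + (2:ℝ) * t * Q * v₁ * T + t * Q * v₂ * v₂ + ((1:ℝ)/2) * t * Q * v₂ * v₃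
          + t * Q * v₂ * T + t * Q * v₃ * v₃ + ((1:ℝ)/2) * t * Q * v₃ * T + ((1:ℝ)/2) * t * Q * T * T
          + ((3:ℝ)/2) * t * v₁ * v₃ * v₃ + ((1:ℝ)/2) * t * v₁ * v₃ * T + ((1:ℝ)/2) * t * v₂ * v₃ * v₃) * ((AG q u₁ u₂ u₃ t))
      + (q * Q + ((3:ℝ)/2) * t * v₃) * ((AG q u₁ u₂ u₃ t) * (AG Q v₁ v₂ v₃ T))
      + (q * q * u₁ * v₂ + q * q * u₁ * v₃ + q * q * u₁ * T + q * q * u₂ * v₁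
          + q * q * u₂ * v₃ + q * q * u₂ * T + q * q * u₃ * v₁ + q * q * u₃ * v₂
          + q * q * u₃ * T + (2:ℝ) * q * q * t * Q + q * q * t * v₁ + q * q * t * v₂
          + (2:ℝ) * q * q * t * v₃ + (2:ℝ) * q * q * t * T + q * u₁ * u₁ * v₂ + q * u₁ * u₁ * v₃
          + q * u₁ * u₁ * T + q * u₁ * u₂ * v₁ + q * u₁ * u₂ * v₂ + (2:ℝ) * q * u₁ * u₂ * T
          + q * u₁ * u₃ * v₁ + q * u₁ * u₃ * v₂ + (2:ℝ) * q * u₁ * u₃ * T + q * u₁ * t * v₁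
          + (2:ℝ) * q * u₁ * t * v₂ + (2:ℝ) * q * u₁ * t * v₃ + q * u₁ * t * T + q * u₂ * u₂ * v₁
          + q * u₂ * u₂ * v₃ + q * u₂ * u₂ * T + q * u₂ * u₃ * v₁ + q * u₂ * u₃ * v₂
          + (2:ℝ) * q * u₂ * u₃ * T + (2:ℝ) * q * u₂ * t * v₁ + q * u₂ * t * v₂ + q * u₂ * t * v₃
          + q * u₂ * t * T + q * u₃ * u₃ * v₁ + q * u₃ * u₃ * v₂ + q * u₃ * u₃ * T
          + (2:ℝ) * q * u₃ * t * v₁ + (2:ℝ) * q * u₃ * t * v₂ + q * u₃ * t * v₃ + q * u₃ * t * T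
          + u₁ * u₂ * t * v₁ + u₁ * u₂ * t * v₂ + u₁ * u₃ * t * v₁ + u₁ * u₃ * t * v₃
          + u₂ * u₂ * u₃ * v₃ + u₂ * u₃ * t * v₂ + u₂ * u₃ * t * v₃) * ((AG Q v₁ v₂ v₃ T))
      + (Q * Q * Q + Q * Q * v₁ + Q * Q * v₂ + Q * Q * v₃
          + (2:ℝ) * Q * v₁ * v₂ + (2:ℝ) * Q * v₁ * v₃ + (2:ℝ) * Q * v₂ * v₃ + Q * v₂ * T
          + ((1:ℝ)/2) * v₁ * v₂ * T + v₂ * v₃ * v₃ + ((1:ℝ)/2) * v₂ * v₃ * T) * ((Hqt q u₁ u₂ u₃ t))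
      + (q * q * q + q * q * u₁ + q * q * u₂ + q * q * u₃
          + ((1:ℝ)/2) * q * u₁ * t + ((1:ℝ)/2) * q * u₃ * t + ((1:ℝ)/2) * q * t * t + ((1:ℝ)/2) * u₁ * u₁ * u₂
          + ((1:ℝ)/2) * u₁ * u₁ * u₃ + u₁ * u₂ * u₂ + ((1:ℝ)/2) * u₁ * u₂ * t + ((1:ℝ)/2) * u₁ * u₃ * u₃
          + ((1:ℝ)/2) * u₁ * u₃ * t + u₂ * u₂ * u₃ + ((1:ℝ)/2) * u₂ * u₃ * u₃ + ((1:ℝ)/2) * u₂ * u₃ * t) * ((Hqt Q v₁ v₂ v₃ T)) := by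
    simp only [Hqt, AG]; ring
  rw [key]
  generalize Hqt q u₁ u₂ u₃ t = RX at hrx ⊢
  generalize Hqt Q v₁ v₂ v₃ T = RY at hry ⊢
  generalize AG q u₁ u₂ u₃ t = AX at hagx ⊢
  generalize AG Q v₁ v₂ v₃ T = AY at hagy ⊢
  positivity

/-- **`{AG ≥ 0, Ξ ≥ 0}` is closed under the meet composition** (self-duality + `Xi_join_nonneg`). [cite: Gladkov2024StrongFKG, Cor. 4.2 (AG)] -/
theorem Xi_meet_nonneg {q u₁ u₂ u₃ t Q v₁ v₂ v₃ T zq z₁ z₂ z₃ zt : ℝ}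
    (hq : 0 ≤ q) (hu₁ : 0 ≤ u₁) (hu₂ : 0 ≤ u₂) (hu₃ : 0 ≤ u₃) (ht : 0 ≤ t)
    (hQ : 0 ≤ Q) (hv₁ : 0 ≤ v₁) (hv₂ : 0 ≤ v₂) (hv₃ : 0 ≤ v₃) (hT : 0 ≤ T)
    (hagx : 0 ≤ AG q u₁ u₂ u₃ t) (hagy : 0 ≤ AG Q v₁ v₂ v₃ T)
    (hrx : 0 ≤ Xi q u₁ u₂ u₃ t) (hry : 0 ≤ Xi Q v₁ v₂ v₃ T)
    (hzt : zt = t * T) (hz₁ : z₁ = t * v₁ + u₁ * T + u₁ * v₁) (hz₂ : z₂ = t * v₂ + u₂ * T + u₂ * v₂)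
    (hz₃ : z₃ = t * v₃ + u₃ * T + u₃ * v₃)
    (hzq : zq = q * (T + v₁ + v₂ + v₃ + Q) + Q * (t + u₁ + u₂ + u₃) + (u₁ * (v₂ + v₃) + u₂ * (v₁ + v₃) + u₃ * (v₁ + v₂))) :
    0 ≤ Xi zq z₁ z₂ z₃ zt := by
  have hagx' : 0 ≤ AG t u₁ u₂ u₃ q := by rw [AG_dual]; exact hagx
  have hagy' : 0 ≤ AG T v₁ v₂ v₃ Q := by rw [AG_dual]; exact hagy
  have hrx' : 0 ≤ Xi t u₁ u₂ u₃ q := by rw [Xi_dual]; exact hrx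
  have hry' : 0 ≤ Xi T v₁ v₂ v₃ Q := by rw [Xi_dual]; exact hry
  have h := Xi_join_nonneg ht hu₁ hu₂ hu₃ hq hT hv₁ hv₂ hv₃ hQ hagx' hagy' hrx' hry' rfl rfl rfl rfl rfl
  rw [← Xi_dual]
  subst hzt hz₁ hz₂ hz₃ hzq
  exact h

/-- **`{AG ≥ 0, H_{q+t} ≥ 0}` is closed under the meet composition** (self-duality + `Hqt_join_nonneg`). [cite: Gladkov2024StrongFKG, Cor. 4.2 (AG)] -/
theorem Hqt_meet_nonneg {q u₁ u₂ u₃ t Q v₁ v₂ v₃ T zq z₁ z₂ z₃ zt : ℝ}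
    (hq : 0 ≤ q) (hu₁ : 0 ≤ u₁) (hu₂ : 0 ≤ u₂) (hu₃ : 0 ≤ u₃) (ht : 0 ≤ t)
    (hQ : 0 ≤ Q) (hv₁ : 0 ≤ v₁) (hv₂ : 0 ≤ v₂) (hv₃ : 0 ≤ v₃) (hT : 0 ≤ T)
    (hagx : 0 ≤ AG q u₁ u₂ u₃ t) (hagy : 0 ≤ AG Q v₁ v₂ v₃ T)
    (hrx : 0 ≤ Hqt q u₁ u₂ u₃ t) (hry : 0 ≤ Hqt Q v₁ v₂ v₃ T)
    (hzt : zt = t * T) (hz₁ : z₁ = t * v₁ + u₁ * T + u₁ * v₁) (hz₂ : z₂ = t * v₂ + u₂ * T + u₂ * v₂)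
    (hz₃ : z₃ = t * v₃ + u₃ * T + u₃ * v₃)
    (hzq : zq = q * (T + v₁ + v₂ + v₃ + Q) + Q * (t + u₁ + u₂ + u₃) + (u₁ * (v₂ + v₃) + u₂ * (v₁ + v₃) + u₃ * (v₁ + v₂))) :
    0 ≤ Hqt zq z₁ z₂ z₃ zt := by
  have hagx' : 0 ≤ AG t u₁ u₂ u₃ q := by rw [AG_dual]; exact hagx
  have hagy' : 0 ≤ AG T v₁ v₂ v₃ Q := by rw [AG_dual]; exact hagy
  have hrx' : 0 ≤ Hqt t u₁ u₂ u₃ q := by rw [Hqt_dual]; exact hrx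
  have hry' : 0 ≤ Hqt T v₁ v₂ v₃ Q := by rw [Hqt_dual]; exact hry
  have h := Hqt_join_nonneg ht hu₁ hu₂ hu₃ hq hT hv₁ hv₂ hv₃ hQ hagx' hagy' hrx' hry' rfl rfl rfl rfl rfl
  rw [← Hqt_dual]
  subst hzt hz₁ hz₂ hz₃ hzq
  exact h

end CubicThreePointRowClosure

/-! ## Graph level -/

namespace TerminalGluing

open Finset Literature.Probability.Percolation Literature.Probability.Percolation.DecisionTree
open CubicThreePointTerminal CubicThreePointStep CubicThreePointJoin CubicThreePointRowClosure

variable {V : Type*} [DecidableEq V]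

section JoinRows

variable {D₁ D₂ K₁ K₂ : Finset (Sym2 V)} {p : Sym2 V → ℝ} {a b c : V} (hp0 : ∀ i, 0 ≤ p i) (hp1 : ∀ i, p i ≤ 1)
  (hD : Disjoint D₁ D₂) (hsep : ∀ v : V, ∀ e₁ ∈ D₁ ∪ K₁, ∀ e₂ ∈ D₂ ∪ K₂, v ∈ e₁ → v ∈ e₂ → (v = a ∨ v = b ∨ v = c))
include hp0 hp1 hD hsep

omit hp0 hp1 in
/-- The `abc` cell of the glued system in join form. [folklore] -/
theorem PrW_join_T' :
    PrW (D₁ ∪ D₂) p (evT (K₁ ∪ K₂) a b c) =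
      PrW D₁ p (evT K₁ a b c) * (PrW D₂ p (evQ K₂ a b c) + PrW D₂ p (evU₁ K₂ a b c) + PrW D₂ p (evU₂ K₂ a b c) + PrW D₂ p (evU₃ K₂ a b c)
          + PrW D₂ p (evT K₂ a b c)) +
        PrW D₂ p (evT K₂ a b c) * (PrW D₁ p (evQ K₁ a b c) + PrW D₁ p (evU₁ K₁ a b c) + PrW D₁ p (evU₂ K₁ a b c) + PrW D₁ p (evU₃ K₁ a b c)) +
        (PrW D₁ p (evU₁ K₁ a b c) * (PrW D₂ p (evU₂ K₂ a b c) + PrW D₂ p (evU₃ K₂ a b c)) +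
          PrW D₁ p (evU₂ K₁ a b c) * (PrW D₂ p (evU₁ K₂ a b c) + PrW D₂ p (evU₃ K₂ a b c)) +
          PrW D₁ p (evU₃ K₁ a b c) * (PrW D₂ p (evU₁ K₂ a b c) + PrW D₂ p (evU₂ K₂ a b c))) := by
  have hσ₁ := PrW_cells_sum_one D₁ p K₁ a b c
  have hσ₂ := PrW_cells_sum_one D₂ p K₂ a b c
  rw [PrW_join_T p hD hsep]
  linear_combination (-(PrW D₁ p (evT K₁ a b c))) * hσ₂ + (-(PrW D₂ p (evT K₂ a b c))) * hσ₁

/-- **Terminal gluing preserves AG⁺** of the finitary law. [cite: Gladkov2024StrongFKG, Cor. 4.2 (AG)] -/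
theorem xiW_join_nonneg (h₁ : 0 ≤ Xi (PrW D₁ p (evQ K₁ a b c)) (PrW D₁ p (evU₁ K₁ a b c)) (PrW D₁ p (evU₂ K₁ a b c)) (PrW D₁ p (evU₃ K₁ a b c)) (PrW D₁ p (evT K₁ a b c))) (h₂ : 0 ≤ Xi (PrW D₂ p (evQ K₂ a b c)) (PrW D₂ p (evU₁ K₂ a b c)) (PrW D₂ p (evU₂ K₂ a b c)) (PrW D₂ p (evU₃ K₂ a b c)) (PrW D₂ p (evT K₂ a b c))) :
    0 ≤ Xi (PrW (D₁ ∪ D₂) p (evQ (K₁ ∪ K₂) a b c)) (PrW (D₁ ∪ D₂) p (evU₁ (K₁ ∪ K₂) a b c)) (PrW (D₁ ∪ D₂) p (evU₂ (K₁ ∪ K₂) a b c)) (PrW (D₁ ∪ D₂) p (evU₃ (K₁ ∪ K₂) a b c)) (PrW (D₁ ∪ D₂) p (evT (K₁ ∪ K₂) a b c)) :=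
  Xi_join_nonneg (PrW_nonneg D₁ hp0 hp1 _) (PrW_nonneg D₁ hp0 hp1 _) (PrW_nonneg D₁ hp0 hp1 _) (PrW_nonneg D₁ hp0 hp1 _)
    (PrW_nonneg D₁ hp0 hp1 _) (PrW_nonneg D₂ hp0 hp1 _) (PrW_nonneg D₂ hp0 hp1 _) (PrW_nonneg D₂ hp0 hp1 _) (PrW_nonneg D₂ hp0 hp1 _)
    (PrW_nonneg D₂ hp0 hp1 _) (AG_PrW_nonneg a b c hp0 hp1 D₁ K₁) (AG_PrW_nonneg a b c hp0 hp1 D₂ K₂) h₁ h₂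
    (PrW_join_Q p hD hsep) (PrW_join_U₁ p hD hsep) (PrW_join_U₂ p hD hsep) (PrW_join_U₃ p hD hsep) (PrW_join_T' hD hsep)

/-- **Terminal gluing preserves `H_{q+t} ≥ 0`** of the finitary law. [cite: Gladkov2024StrongFKG, Cor. 4.2 (AG)] -/
theorem hqtW_join_nonneg (h₁ : 0 ≤ Hqt (PrW D₁ p (evQ K₁ a b c)) (PrW D₁ p (evU₁ K₁ a b c)) (PrW D₁ p (evU₂ K₁ a b c)) (PrW D₁ p (evU₃ K₁ a b c)) (PrW D₁ p (evT K₁ a b c))) (h₂ : 0 ≤ Hqt (PrW D₂ p (evQ K₂ a b c)) (PrW D₂ p (evU₁ K₂ a b c)) (PrW D₂ p (evU₂ K₂ a b c)) (PrW D₂ p (evU₃ K₂ a b c)) (PrW D₂ p (evT K₂ a b c))) :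
    0 ≤ Hqt (PrW (D₁ ∪ D₂) p (evQ (K₁ ∪ K₂) a b c)) (PrW (D₁ ∪ D₂) p (evU₁ (K₁ ∪ K₂) a b c)) (PrW (D₁ ∪ D₂) p (evU₂ (K₁ ∪ K₂) a b c)) (PrW (D₁ ∪ D₂) p (evU₃ (K₁ ∪ K₂) a b c)) (PrW (D₁ ∪ D₂) p (evT (K₁ ∪ K₂) a b c)) :=
  Hqt_join_nonneg (PrW_nonneg D₁ hp0 hp1 _) (PrW_nonneg D₁ hp0 hp1 _) (PrW_nonneg D₁ hp0 hp1 _) (PrW_nonneg D₁ hp0 hp1 _)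
    (PrW_nonneg D₁ hp0 hp1 _) (PrW_nonneg D₂ hp0 hp1 _) (PrW_nonneg D₂ hp0 hp1 _) (PrW_nonneg D₂ hp0 hp1 _) (PrW_nonneg D₂ hp0 hp1 _)
    (PrW_nonneg D₂ hp0 hp1 _) (AG_PrW_nonneg a b c hp0 hp1 D₁ K₁) (AG_PrW_nonneg a b c hp0 hp1 D₂ K₂) h₁ h₂
    (PrW_join_Q p hD hsep) (PrW_join_U₁ p hD hsep) (PrW_join_U₂ p hD hsep) (PrW_join_U₃ p hD hsep) (PrW_join_T' hD hsep)

end JoinRows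

end TerminalGluing

end Summit.CriticalPhenomena.PercolationContinuityZ3.Theorems
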